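import Summits.BirchSwinnertonDyer.BirchSwinnertonDyer.Theorems.GenusKolyvaginAtTwoPowDvdShaCardAtTwoRTBottomRungEngineDeepTwoN
import Summits.BirchSwinnertonDyer.BirchSwinnertonDyer.Theorems.GenusKolyvaginAtTwoPowDvdShaCardAtTwoRTMinimalWitnessLoop
import Summits.BirchSwinnertonDyer.BirchSwinnertonDyer.Theorems.GenusKolyvaginAtTwoPowDvdShaCardAtTwoRTRungSupplyKolyvagin
import Summits.BirchSwinnertonDyer.BirchSwinnertonDyer.Theorems.GenusKolyvaginAtTwoPowDvdShaCardAtTwoRTMinimaStep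
import Summits.BirchSwinnertonDyer.BirchSwinnertonDyer.Theorems.GenusKolyvaginAtTwoVisiblePairAtTwoKolyvaginClassSign
import Summits.BirchSwinnertonDyer.BirchSwinnertonDyer.Theorems.ByReductionTypeAtTwoRankOneAtTwoBigImageOddLocalOneDoorBottomLemma43AtTwo
import Summits.BirchSwinnertonDyer.BirchSwinnertonDyer.Theorems.Rank1ResidualJetCompatibleData
import Summits.BirchSwinnertonDyer.BirchSwinnertonDyer.Theorems.Rank1ResidualJetCompatibleDataDown
import Literature.NumberTheory.EllipticCurves.HeegnerPointsKolyvaginDepthDescent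
import Literature.NumberTheory.QuadraticFields.ThreeTorsion
import HarnessLib

/-!
# Route `GenusKolyvaginAtTwo`, crux L_T `PowDvdShaCardAtTwoRT` (stmt-BirchSwinnertonDyer-23242), LINE 18 stub KS, THE BOTTOM RUNG CLOSED
# modulo (NPh), the (V44)-socket and Q2: a level-4 GROSS witness yields an ALL-DEEP 2-primitive product of the same size

LEAD seat `bsd-line-gk2-p1` g17 (cell `bsd-f1-sign2`), `--supports 23242 --as helper`.  THEOREMS ONLY; no `sorry`; standard axioms.
BSD is NOT proved by any of this; neither is the crux, nor stub KS, nor stub L.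

WHY (memo `Cruxes/PowDvdShaCardAtTwoRT/Lines/plus-descent-lead-g17.md` §5–§6).  `Mr R = 0` in (KS) (= «some all-deep square-free product is
2-primitive», `…RTKolyvaginMinima.exists_kolyvaginMinima` last clause) is reached from a SHALLOW witness by gk2-p4's k-minimal loop
`PlusDescent.exists_all_deep_of_engine_card`, whose one step is this seat's deep engine `false_of_bottomRung_engine_deep'`.  This file feeds the
loop: the admissibility predicate «`S` = the primes of a square-free `n`, all level-4 GROSS–Kolyvagin (`Frob = Frob_∞` on `K(E[4])`, index `≥ 2`),
with a datum whose level-4 class is primitive», the deep predicate «index `≥ L`, `Frob = Frob_∞` on `K(E[2^L])`», and the discharge of EVERY clause of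
the engine's `hstep` from tree theorems: (desc) by the eigen description `EigenClassesFinite.mem_range_resTorsion_iff_conjAct_eq` (sign `+1` by Gross
5.4 at 2 and the displayed PARITY of the witness), (Kum) by Gross 6.2(1) at 2 (`RankOneAtTwoOneDoor.kolyvaginClass_two_mem_selmerLocalKer_of_odd_tamagawaProduct`),
(Q2@λ′) and the free clauses by Q2 BY NAME on COHERENT data (`JET.exists_compatible_data_of_grossCM` up, `JET.exists_compatible_datum_of_dvd_of_grossCM`
down, `PlusDescent.kolyvaginRelationAtTwo_of_mul_eq`), (M) from the loop's «every swap is imprimitive», and (tr) from the displayed (V44)-SOCKET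
«`2•desc c₂(n′)` is transverse at every deep own prime of `n′`» (gk2-p3's half-transverse chain from the reduction datum).
* `squarefree_div_mul` — arithmetic of the swap `n ↦ ℓ′·(n/q)`;
* **`exists_deep_primitive_of_gross_witness`** — THE BOTTOM RUNG: from a square-free product `n₀` of level-4 Gross–Kolyvagin primes carrying a datum
  with `addOrderOf c₂ = 4` and the parity `−w(E)(−1)^{ω(n₀)+1} = 1`, an ALL-DEEP square-free product `n` with `ω(n) = ω(n₀)` and a datum with
  `addOrderOf c₂ = 4`, modulo (NPh_L^{2N}), the (V44)-socket and Q2.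
Namespace `…Theorems.GenusExact.RelaxedCount`.  Closes nothing.  BSD is NOT proved by any of this.

References: [McCallumLMS1991] §5 proof of Prop. 5.2, §4 Lemma 4.3, Prop. 4.4, Cor. 4.5; [Kolyvagin1991MathAnn] Thm. 2.2; [GrossLMS1991] §3–§4, Prop. 5.4, 6.2.
-/

set_option autoImplicit false
-- the Theorems namespace of this sub repeats the summit name by design (D-0017 nested layout)
set_option linter.dupNamespace false

noncomputable section

open scoped Classical

open Field NumberField IsDedekindDomain Function WeierstrassCurve Rat.HeightOneSpectrum
open Literature.NumberTheory.EllipticCurves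
open Literature.NumberTheory.GaloisRepresentations
open Literature.NumberTheory.GaloisCohomology
open Summit.BirchSwinnertonDyer.Rank1Residual.X11b.Relaxation
open Summit.BirchSwinnertonDyer.BirchSwinnertonDyer.Theses.GenusKolyvaginAtTwo (KolyvaginRelationAtTwo)
open Summit.BirchSwinnertonDyer.Rank1Residual (X11b.KolyvaginAssembly.discr_lt_neg_four JET.exists_compatible_data_of_grossCM
  JET.exists_compatible_datum_of_dvd_of_grossCM)
open Summit.BirchSwinnertonDyer.BirchSwinnertonDyer.Theorems.GenusExact.SelmerDescent (inertiaDeg_eq_two_of_span_isPrime)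
open Summit.BirchSwinnertonDyer.BirchSwinnertonDyer.Theorems.GenusExact.VisiblePairAtTwo
  (natCast_mem_primesEquiv_symm natGenerator_eq_of_natCast_prime_mem natCast_prime_mem_iff_eq liesOver_of_natCast_mem natCast_mem_of_liesOver
    exists_natCast_mem intCast_notMem_of_not_dvd)

namespace Summit.BirchSwinnertonDyer.BirchSwinnertonDyer.Theorems.GenusExact.RelaxedCount

/-! ## §1 Arithmetic of the swap `n ↦ ℓ′·(n/q)` -/

/-- For `n` square-free, `q ∣ n` prime and `ℓ ∤ n` prime: `m := ℓ·(n/q)` is square-free, `q ∤ m`, `m·q = n·ℓ`, `m ∣ n·ℓ`, and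
`primeFactors m = insert ℓ ((primeFactors n).erase q)`. [folklore] -/
theorem squarefree_div_mul {n q ℓ : ℕ} (hn : Squarefree n) (hq : q ∈ n.primeFactors) (hℓ : ℓ.Prime) (hℓn : ℓ ∉ n.primeFactors) :
    Squarefree (ℓ * (n / q)) ∧ ¬ q ∣ ℓ * (n / q) ∧ ℓ * (n / q) * q = n * ℓ ∧ ℓ * (n / q) ∣ n * ℓ ∧
      (ℓ * (n / q)).primeFactors = insert ℓ (n.primeFactors.erase q) := by
  have hn0 : n ≠ 0 := hn.ne_zero
  obtain ⟨hsq', hmul, hnd, hqp, -, hpf, hnot, -⟩ := KolyvaginDescent.kolSupp_div (Kol := fun _ ↦ True) ⟨hn, fun _ _ ↦ trivial⟩ hq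
  have hℓq : ¬ ℓ ∣ n / q := fun h ↦ hℓn (Nat.mem_primeFactors.mpr ⟨hℓ, h.trans (Nat.div_dvd_of_dvd (Nat.dvd_of_mem_primeFactors hq)), hn0⟩)
  obtain ⟨hsq'', hpf', -, -⟩ := KolyvaginDescent.kolSupp_prime_mul (Kol := fun _ ↦ True) hsq' hℓ trivial hℓq
  have hℓq' : ℓ ≠ q := fun h ↦ hℓn (h ▸ hq)
  refine ⟨hsq''.1, fun h ↦ ?_, by rw [mul_assoc, Nat.div_mul_cancel (Nat.dvd_of_mem_primeFactors hq), mul_comm], ?_, ?_⟩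
  · rcases (Nat.Prime.dvd_mul hqp).mp h with h | h
    · exact hℓq' ((Nat.prime_dvd_prime_iff_eq hqp hℓ).mp h).symm
    · exact hnd h
  · exact ⟨q, by rw [mul_assoc, Nat.div_mul_cancel (Nat.dvd_of_mem_primeFactors hq), mul_comm]⟩
  · rw [hpf', hpf, Finset.erase_insert hnot]

/-! ## §2 The bottom rung from a level-4 Gross witness -/

/-- **THE BOTTOM RUNG OF LINE 18 (level-4 Gross witness ⟹ all-deep primitive product), modulo (NPh), the (V44)-socket and Q2.**  Frame of L_T:
`E/ℚ` globally minimal, non-CM, `Δ < 0`, odd Tamagawa product, `ρ_{E,2^∞}` onto; `K` imaginary quadratic, `d_K` odd `≠ −3`, Heegner, `d_K·(−|Δ|)` not a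
square; a frame `(Dt, β, ι)`; a depth `L ≥ 2`; Q2 (`KolyvaginRelationAtTwo`) granted; **(NPh_L^{2N})** displayed; the **(V44)-socket** displayed («for every
square-free product `n′` of level-4 Gross–Kolyvagin primes, every datum `d′` at `n′`, every `Z ∈ H¹(ℚ,E[4])` with `res_K Z = c₂(d′)` and every own prime
`ℓ ∣ n′` of index `≥ L` with `Frob = Frob_∞` on `K(E[2^L])`: `2•Z` is transverse at `ℓ`» — McCallum Prop. 4.4 (1) at 2, gk2-p3's chain).  WITNESS: a
square-free `n₀` whose primes are Zhang–Kolyvagin of index `≥ 2` with `Frob = Frob_∞` on `K(E[4])`, a datum `e₀` at `n₀` with `addOrderOf c₂(e₀) = 4`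
(`P(n₀) ∉ 2E(K[n₀])`), and the PARITY `−w(E)·(−1)^{ω(n₀)+1} = 1` (so that the swapped classes `c₂(nℓ′)` are `τ`-FIXED and descend to `ℚ` on `E`
itself).  THEN: a square-free `n` with `ω(n) = ω(n₀)`, ALL of whose primes are Zhang–Kolyvagin of index `≥ L` with `Frob = Frob_∞` on `K(E[2^L])`, and
a datum `e` at `n` with `addOrderOf c₂(e) = 4`.  Proof: gk2-p4's k-minimal loop over `false_of_bottomRung_engine_deep'`, every clause of whose `hstep`
is discharged here (module docstring). [cite: McCallumLMS1991, §5 proof of Prop. 5.2; §4 Lemma 4.3, Prop. 4.4] [cite: Kolyvagin1991MathAnn, Thm. 2.2] -/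
theorem exists_deep_primitive_of_gross_witness (W : WeierstrassCurve ℚ) [W.IsElliptic] [W.IsGloballyMinimal] [NeZero (W.conductorNorm ℤ)]
    (hQ2 : KolyvaginRelationAtTwo) (hcm : ¬ W.HasCM) (hΔ : W.Δ < 0) (hT : Odd W.tamagawaProduct)
    (hρ : ∀ m : ℕ, W.HasSurjectiveModNGaloisRep (2 ^ m : ℕ))
    {K : Type} [Field K] [NumberField K] (hK : IsImaginaryQuadratic K) (hodd : Odd (NumberField.discr K))
    (h3 : NumberField.discr K ≠ -3) (hHe : SatisfiesHeegnerHypothesis (W.conductorNorm ℤ) K)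
    (hns : ¬ IsSquare ((NumberField.discr K : ℚ) * -|W.Δ|))
    (Dt : ModularForms.ModularParametrizationData W (W.conductorNorm ℤ)) (β : ℤ) (ι : K →+* ℂ)
    {L : ℕ} (hL2 : 2 ≤ L)
    (hNPh : ∀ z : galH1Torsion (W.baseChange K) ((2 ^ L : ℕ) : ℤ),
      (∀ ρ' ∈ torsionFixing (W.baseChange K) ((2 ^ L : ℕ) : ℤ), h1Eval (W.baseChange K) ((2 ^ L : ℕ) : ℤ) z ρ' = 0) →
      (∀ w : HeightOneSpectrum (𝓞 K), ((2 * W.conductorNorm ℤ : ℕ) : 𝓞 K) ∈ w.asIdeal →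
        z ∈ selmerLocalKer (W.baseChange K) (w.adicCompletion K) ((2 ^ L : ℕ) : ℤ)) → z = 0)
    (hTr : ∀ (n' : ℕ) (d' : KolyvaginHeegnerData Dt β ι n') (Z : galoisCohomology (W.torsionGaloisModule ((2 ^ 2 : ℕ) : ℤ)) 1),
      Squarefree n' →
      (∀ q ∈ n'.primeFactors, Zhang2014.IsKolyvaginPrime (W.conductorNorm ℤ) W K 2 q ∧ 2 ≤ Zhang2014.kolyvaginIndex W 2 q ∧
        FrobEqFrobInfty W K (2 ^ 2) q) →
      resTorsion W K ((2 ^ 2 : ℕ) : ℤ) Z = d'.kolyvaginClass Nat.prime_two 2 →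
      ∀ (v : HeightOneSpectrum (𝓞 ℚ)) (ℓ : ℕ), ℓ ∈ n'.primeFactors → (ℓ : 𝓞 ℚ) ∈ v.asIdeal →
        L ≤ Zhang2014.kolyvaginIndex W 2 ℓ → FrobEqFrobInfty W K (2 ^ L) ℓ →
        ∀ 𝔓 ∈ v.primesAbove, ∀ F c₀ : absoluteGaloisGroup ℚ, IsArithFrobAt (𝓞 ℚ) F 𝔓 →
          IsComplexConjugation (Rat.castHom ℝ) c₀ → (∀ P : geomTorsion W ((2 ^ 2 : ℕ) : ℤ), F • P = c₀ • P) →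
          ∃ P₁ : geomTorsion W ((2 ^ 2 : ℕ) : ℤ), h1Eval W _ ((2 : ℕ) • Z) F = F • P₁ - P₁)
    -- the witness
    {n₀ : ℕ} (hn₀ : Squarefree n₀)
    (hn₀K : ∀ q ∈ n₀.primeFactors, Zhang2014.IsKolyvaginPrime (W.conductorNorm ℤ) W K 2 q ∧ 2 ≤ Zhang2014.kolyvaginIndex W 2 q ∧
      FrobEqFrobInfty W K (2 ^ 2) q)
    (e₀ : KolyvaginHeegnerData Dt β ι n₀) (he₀ : addOrderOf (e₀.kolyvaginClass Nat.prime_two 2) = 2 ^ 2)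
    (hpar : -W.rootNumber * (-1) ^ (n₀.primeFactors.card + 1) = 1) :
    ∃ (n : ℕ) (e : KolyvaginHeegnerData Dt β ι n), Squarefree n ∧ n.primeFactors.card = n₀.primeFactors.card ∧
      (∀ q ∈ n.primeFactors, Zhang2014.IsKolyvaginPrime (W.conductorNorm ℤ) W K 2 q ∧ L ≤ Zhang2014.kolyvaginIndex W 2 q ∧
        FrobEqFrobInfty W K (2 ^ L) q) ∧
      addOrderOf (e.kolyvaginClass Nat.prime_two 2) = 2 ^ 2 := by
  haveI : Fact (Nat.Prime 2) := ⟨Nat.prime_two⟩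
  have h2K : Module.finrank ℚ K = 2 := hK.1
  have h4 : NumberField.discr K ≠ -4 := fun h ↦ by
    rw [h] at hodd
    exact (Int.not_even_iff_odd.mpr hodd) ⟨-2, by norm_num⟩
  have hD : NumberField.discr K < -4 := X11b.KolyvaginAssembly.discr_lt_neg_four hK ⟨h3, h4⟩
  have hρ2 : W.HasSurjectiveModNGaloisRep 2 := by simpa using hρ 1
  have hsurj1 : W.HasSurjectiveModNGaloisRep ((2 : ℤ) ^ 1) := by exact_mod_cast hρ 1
  have h12 : (1 : ℕ) ≤ 2 := by norm_num
  have hCM := phi_heegnerPointOfConductor_mem_range_map_ringClassField_holds (W.conductorNorm ℤ) W K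
  -- `K = ℚ(θ)`, `θ² = d_K`; the conjugation `σ`
  obtain ⟨θ, hθ', hθsq⟩ := Literature.NumberTheory.QuadraticFields.Quadratic.exists_not_mem_range_sq_eq_discr (K := K) h2K
  have hθ : θ ∉ (algebraMap ℚ K).range := fun ⟨q, hq⟩ ↦ hθ' ⟨q, hq⟩
  have hc : θ ^ 2 = algebraMap ℚ K (NumberField.discr K : ℤ) := hθsq
  set σ : K ≃ₐ[ℚ] K := sigmaQ K h2K hθ' hθsq with hσ_def
  have hσ : σ ≠ 1 := sigmaQ_ne_one K h2K hθ' hθsq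
  have hL4 : ∀ P : (W.baseChange K).toAffine.Point, ((2 ^ 2 : ℕ) : ℤ) • P = 0 → P = 0 :=
    EigenClassesFinite.forall_zsmul_two_pow_baseChange_eq_zero_of_hasSurjectiveModNGaloisRep_two W K h2K hρ2 2
  -- the predicates of the loop
  let Gross : ℕ → Prop := fun q ↦ Zhang2014.IsKolyvaginPrime (W.conductorNorm ℤ) W K 2 q ∧ 2 ≤ Zhang2014.kolyvaginIndex W 2 q ∧
    FrobEqFrobInfty W K (2 ^ 2) q
  let Deep : ℕ → Prop := fun q ↦ Zhang2014.IsKolyvaginPrime (W.conductorNorm ℤ) W K 2 q ∧ L ≤ Zhang2014.kolyvaginIndex W 2 q ∧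
    FrobEqFrobInfty W K (2 ^ L) q
  have hDeepGross : ∀ q, Deep q → Gross q := fun q hq ↦ ⟨hq.1, hL2.trans hq.2.1, hq.2.2.of_dvd (pow_dvd_pow 2 hL2)⟩
  let P : Finset ℕ → Prop := fun S ↦ ∃ (n : ℕ) (e : KolyvaginHeegnerData Dt β ι n), Squarefree n ∧ n.primeFactors = S ∧
    (∀ q ∈ n.primeFactors, Gross q) ∧ addOrderOf (e.kolyvaginClass Nat.prime_two 2) = 2 ^ 2
  -- ### run the loop
  suffices hloop : ∃ S, S.card = n₀.primeFactors.card ∧ P S ∧ ∀ l ∈ S, Deep l by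
    obtain ⟨S, hScard, ⟨n, e, hn, hpf, hGr, he⟩, hdeep⟩ := hloop
    refine ⟨n, e, hn, by rw [hpf, hScard], fun q hq ↦ ?_, he⟩
    exact hdeep q (hpf ▸ hq)
  refine PlusDescent.exists_all_deep_of_engine_card Deep P n₀.primeFactors.card ?_ n₀.primeFactors rfl ⟨n₀, e₀, hn₀, rfl, hn₀K, he₀⟩
  -- ### the engine step
  intro S hScard hPS q₀ hq₀S hq₀ hno
  obtain ⟨n, e, hn, hpf, hGr, he⟩ := hPS
  subst hpf
  have hn0 : n ≠ 0 := hn.ne_zero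
  have hnK : ∀ q ∈ n.primeFactors, Zhang2014.IsKolyvaginPrime (W.conductorNorm ℤ) W K 2 q ∧ 2 ≤ Zhang2014.kolyvaginIndex W 2 q :=
    fun q hq ↦ ⟨(hGr q hq).1, (hGr q hq).2.1⟩
  -- places of the own primes: free `s` (non-deep) and deep `t`
  let pl : ℕ → Place ℚ := fun q ↦ if hq : q.Prime then Sum.inr (primesEquiv.symm ⟨q, hq⟩) else Sum.inr (primesEquiv.symm ⟨2, Nat.prime_two⟩)
  have hpl : ∀ {q : ℕ} (hq : q.Prime), pl q = Sum.inr (primesEquiv.symm ⟨q, hq⟩) := fun hq ↦ by simp only [pl, dif_pos hq]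
  have hplmem : ∀ {q : ℕ} (hq : q.Prime), (q : 𝓞 ℚ) ∈ (primesEquiv.symm ⟨q, hq⟩ : HeightOneSpectrum (𝓞 ℚ)).asIdeal :=
    fun hq ↦ natCast_mem_primesEquiv_symm hq
  let s : Finset (Place ℚ) := (n.primeFactors.filter fun q ↦ ¬ Deep q).image pl
  let t : Finset (Place ℚ) := (n.primeFactors.filter fun q ↦ Deep q).image pl
  -- reading a place of `s ∪ t` back to its prime
  have hback : ∀ u ∈ s ∪ t, ∃ q ∈ n.primeFactors, u = pl q := by
    intro u hu
    rcases Finset.mem_union.mp hu with hu | hu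
    · obtain ⟨q, hq, rfl⟩ := Finset.mem_image.mp hu
      exact ⟨q, (Finset.mem_filter.mp hq).1, rfl⟩
    · obtain ⟨q, hq, rfl⟩ := Finset.mem_image.mp hu
      exact ⟨q, (Finset.mem_filter.mp hq).1, rfl⟩
  have hpl_inj : ∀ {q q' : ℕ}, q.Prime → q'.Prime → pl q = pl q' → q = q' := by
    intro q q' hq hq' h
    rw [hpl hq, hpl hq'] at h
    have h' := Sum.inr_injective h
    have := congrArg (fun v : HeightOneSpectrum (𝓞 ℚ) ↦ (primesEquiv v : ℕ)) h'
    simpa using this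
  have hmem_st : ∀ q ∈ n.primeFactors, pl q ∈ s ∪ t := by
    intro q hq
    by_cases hd : Deep q
    · exact Finset.mem_union_right _ (Finset.mem_image.mpr ⟨q, Finset.mem_filter.mpr ⟨hq, hd⟩, rfl⟩)
    · exact Finset.mem_union_left _ (Finset.mem_image.mpr ⟨q, Finset.mem_filter.mpr ⟨hq, hd⟩, rfl⟩)
  -- a place of `K` not over `s ∪ t` does not divide `n`
  have hoff : ∀ w : HeightOneSpectrum (𝓞 K), (Sum.inr (w.under (𝓞 ℚ)) : Place ℚ) ∉ s ∪ t → (n : 𝓞 K) ∉ w.asIdeal := by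
    intro w hw
    refine natCast_notMem_of_forall_primeFactors (K := K) hn w fun q hq hqw ↦ hw ?_
    have hqp : q.Prime := Nat.prime_of_mem_primeFactors hq
    have hunder : (q : 𝓞 ℚ) ∈ (w.under (𝓞 ℚ)).asIdeal := by
      change (q : 𝓞 ℚ) ∈ w.asIdeal.under (𝓞 ℚ)
      rw [Ideal.under_def, Ideal.mem_comap, map_natCast]
      exact hqw
    have heq : w.under (𝓞 ℚ) = primesEquiv.symm ⟨q, hqp⟩ := (natCast_prime_mem_iff_eq hqp _).mp hunder
    rw [heq, ← hpl hqp]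
    exact hmem_st q hq
  -- ### the engine's hypotheses
  have hst : Disjoint s t := by
    rw [Finset.disjoint_left]
    intro u hus hut
    obtain ⟨q, hq, rfl⟩ := Finset.mem_image.mp hus
    obtain ⟨q', hq', h⟩ := Finset.mem_image.mp hut
    obtain ⟨hqn, hqd⟩ := Finset.mem_filter.mp hq
    obtain ⟨hq'n, hq'd⟩ := Finset.mem_filter.mp hq'
    have := hpl_inj (Nat.prime_of_mem_primeFactors hq'n) (Nat.prime_of_mem_primeFactors hqn) h
    exact hqd (this ▸ hq'd)
  have hs : s.Nonempty := ⟨pl q₀, Finset.mem_image.mpr ⟨q₀, Finset.mem_filter.mpr ⟨hq₀S, hq₀⟩, rfl⟩⟩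
  have hTK : ∀ u ∈ s ∪ t, ∃ (v : HeightOneSpectrum (𝓞 ℚ)) (ℓ : ℕ) (_ : Fact ℓ.Prime), u = Sum.inr v ∧ ℓ ≠ 2 ∧ (ℓ : 𝓞 ℚ) ∈ v.asIdeal ∧
      W.HasGoodReductionAtPrime ℓ ∧ FrobEqFrobInfty W K 2 ℓ ∧ 2 ≤ Zhang2014.kolyvaginIndex W 2 ℓ ∧
      Zhang2014.IsKolyvaginPrime (W.conductorNorm ℤ) W K 2 ℓ := by
    intro u hu
    obtain ⟨q, hq, rfl⟩ := hback u hu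
    have hqp : q.Prime := Nat.prime_of_mem_primeFactors hq
    obtain ⟨hKol, hidx, hFrob4⟩ := hGr q hq
    haveI : Fact q.Prime := ⟨hqp⟩
    exact ⟨_, q, ⟨hqp⟩, hpl hqp, hKol.2.2.2.1, hplmem hqp, hasGoodReductionAtPrime_of_not_dvd_conductorNorm W hKol.2.1,
      hFrob4.of_dvd ⟨2, by norm_num⟩, hidx, hKol⟩
  have ht4 : ∀ (v : HeightOneSpectrum (𝓞 ℚ)) (ℓ : ℕ), ℓ.Prime → Sum.inr v ∈ t → (ℓ : 𝓞 ℚ) ∈ v.asIdeal →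
      FrobEqFrobInfty W K (2 ^ 2) ℓ := by
    intro v ℓ hℓp hvt hℓv
    obtain ⟨q, hq, h⟩ := Finset.mem_image.mp hvt
    obtain ⟨hqn, hqd⟩ := Finset.mem_filter.mp hq
    have hqp : q.Prime := Nat.prime_of_mem_primeFactors hqn
    rw [hpl hqp] at h
    have hv : v = primesEquiv.symm ⟨q, hqp⟩ := (Sum.inr_injective h).symm
    have hℓq : ℓ = q := by
      have h1 := natGenerator_eq_of_natCast_prime_mem hℓp hℓv
      have h2 := natGenerator_eq_of_natCast_prime_mem hqp (hv ▸ hplmem hqp)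
      exact h1.symm.trans h2
    subst hℓq
    exact hqd.2.2.of_dvd (pow_dvd_pow 2 hL2)
  -- the class `c₂(n)`: order `4`, eigen, Selmer off `n`
  set cK := e.kolyvaginClass Nat.prime_two 2 with hcK_def
  obtain ⟨hsgn, hτcK⟩ := KolyvaginClassSign.sign_conjAct_kolyvaginClass_two hK h3 h4 hodd hHe hsurj1 σ hσ Dt β ι hn h12 hnK e
  have hcKsel : ∀ w : HeightOneSpectrum (𝓞 K), (Sum.inr (w.under (𝓞 ℚ)) : Place ℚ) ∉ s ∪ t →
      cK ∈ selmerLocalKer (W.baseChange K) (w.adicCompletion K) ((2 ^ 2 : ℕ) : ℤ) := fun w hw ↦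
    RankOneAtTwoOneDoor.kolyvaginClass_two_mem_selmerLocalKer_of_odd_tamagawaProduct W hρ hT K hK h3 h4 hHe Dt β ι 2 hn hnK e w
      (hoff w hw)
  refine false_of_bottomRung_engine_deep' W hcm hΔ hρ hK hns hθ hc σ hσ hL2 s t hst hs hTK ht4 cK he hsgn hτcK hcKsel hNPh
    fun y _ _ ↦ ⟨∅, ?_⟩
  -- ### the bookkeeping at a deep new prime `ℓ′`
  intro ℓ' v' w' hw'v' _ hℓ'p hℓ'v' hℓ'w' hKol' hFrobL hidxL hv'out hOrdZ hOrdY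
  have hdeep' : Deep ℓ' := ⟨hKol', hidxL, hFrobL⟩
  have hGross' : Gross ℓ' := hDeepGross ℓ' hdeep'
  have hv'eq : v' = primesEquiv.symm ⟨ℓ', hℓ'p⟩ := (natCast_prime_mem_iff_eq hℓ'p _).mp hℓ'v'
  have hℓ'n : ℓ' ∉ n.primeFactors := fun h ↦ hv'out (by rw [hv'eq, ← hpl hℓ'p]; exact hmem_st ℓ' h)
  have hℓ'dvd : ¬ ℓ' ∣ n := fun h ↦ hℓ'n (Nat.mem_primeFactors.mpr ⟨hℓ'p, h, hn0⟩)
  have hsq : Squarefree (n * ℓ') :=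
    (Nat.squarefree_mul ((Nat.Prime.coprime_iff_not_dvd hℓ'p).mpr hℓ'dvd).symm).mpr ⟨hn, hℓ'p.squarefree⟩
  have hpf' : (n * ℓ').primeFactors = insert ℓ' n.primeFactors := by
    rw [Nat.primeFactors_mul hn0 hℓ'p.ne_zero, hℓ'p.primeFactors, Finset.union_comm]; rfl
  have hGr' : ∀ q ∈ (n * ℓ').primeFactors, Gross q := by
    intro q hq
    rw [hpf', Finset.mem_insert] at hq
    rcases hq with rfl | hq
    · exact hGross'
    · exact hGr q hq
  have hnK' : ∀ q ∈ (n * ℓ').primeFactors, Zhang2014.IsKolyvaginPrime (W.conductorNorm ℤ) W K 2 q ∧ 2 ≤ Zhang2014.kolyvaginIndex W 2 q :=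
    fun q hq ↦ ⟨(hGr' q hq).1, (hGr' q hq).2.1⟩
  have hcard' : (n * ℓ').primeFactors.card = n.primeFactors.card + 1 := by
    rw [hpf', Finset.card_insert_of_notMem hℓ'n]
  -- the datum at `nℓ′` (Gross's CM construction) and its class
  obtain ⟨dℓ, hdℓ⟩ := JET.exists_compatible_data_of_grossCM hCM hK hD hHe 2 Dt β ι hn (fun q hq ↦ (hnK q hq).1) e
  obtain ⟨hσc, hSc, hSc', hembc⟩ := hdℓ ℓ' hKol' hℓ'n
  set d' := dℓ ℓ' hKol' hℓ'n with hd'_def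
  set cK' := d'.kolyvaginClass Nat.prime_two 2 with hcK'_def
  -- (desc): `cK′` is `σ`-fixed (parity), hence a restriction from `ℚ`
  obtain ⟨-, hτcK'⟩ := KolyvaginClassSign.sign_conjAct_kolyvaginClass_two hK h3 h4 hodd hHe hsurj1 σ hσ Dt β ι hsq h12 hnK' d'
  have hsign' : -W.rootNumber * (-1) ^ (n * ℓ').primeFactors.card = 1 := by rw [hcard', hScard]; exact hpar
  rw [hsign', one_smul] at hτcK'
  obtain ⟨Z, hZ⟩ := (EigenClassesFinite.mem_range_resTorsion_iff_conjAct_eq W K h2K hθ' hθsq _ hL4 cK').mpr hτcK'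
  refine ⟨Z, cK', hZ, ?_, ?_, ?_, ?_⟩
  · -- (Kum): `cK′` Selmer at the places not over `nℓ′`
    intro v hv w hwv
    haveI := hwv
    refine RankOneAtTwoOneDoor.kolyvaginClass_two_mem_selmerLocalKer_of_odd_tamagawaProduct W hρ hT K hK h3 h4 hHe Dt β ι 2 hsq hnK' d' w
      (natCast_notMem_of_forall_primeFactors (K := K) hsq w fun q hq hqw ↦ hv ?_)
    have hqp : q.Prime := Nat.prime_of_mem_primeFactors hq
    have hqv : (q : 𝓞 ℚ) ∈ v.asIdeal := by
      rw [Ideal.LiesOver.over (P := w.asIdeal) (p := v.asIdeal), Ideal.under_def, Ideal.mem_comap, map_natCast]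
      exact hqw
    have hveq : v = primesEquiv.symm ⟨q, hqp⟩ := (natCast_prime_mem_iff_eq hqp _).mp hqv
    rw [hpf', Finset.mem_insert] at hq
    rcases hq with rfl | hq
    · rw [hveq, ← hv'eq]; exact Finset.mem_insert_self _ _
    · exact Finset.mem_insert_of_mem (by rw [hveq, ← hpl hqp]; exact hmem_st q hq)
  · -- (Q2@w′)
    intro j
    exact PlusDescent.kolyvaginRelationAtTwo_of_mul_eq W Dt β ι hQ2 hcm hK h3 h4 hHe hρ 2 h12 rfl hsq hℓ'p hℓ'dvd hnK' e d' hσc hSc hSc'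
      hembc w' hℓ'w' j
  · -- (free) + (M): at each free own prime `u = pl q`
    intro u hu
    obtain ⟨q, hqf, rfl⟩ := Finset.mem_image.mp hu
    obtain ⟨hq, hqd⟩ := Finset.mem_filter.mp hqf
    have hqp : q.Prime := Nat.prime_of_mem_primeFactors hq
    obtain ⟨hKolq, -, hFrob4q⟩ := hGr q hq
    -- the swapped product `m = ℓ′·(n/q)` and a datum there coherent with `d′`
    have hq' : q ∈ (n * ℓ').primeFactors := by rw [hpf']; exact Finset.mem_insert_of_mem hq
    have hℓ'n' : ℓ' ∉ n.primeFactors := hℓ'n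
    obtain ⟨hmsq, hqm, hmq, hmdvd, hmpf⟩ := squarefree_div_mul hn hq hℓ'p hℓ'n'
    obtain ⟨d'', hσ'', hS'', hS''', hemb''⟩ := JET.exists_compatible_datum_of_dvd_of_grossCM hK hD hHe 2 Dt β ι hsq (fun q hq ↦ (hnK' q hq).1)
      hmdvd d'
    set cKu := d''.kolyvaginClass Nat.prime_two 2 with hcKu_def
    obtain ⟨w, hqw⟩ := exists_natCast_mem (K := K) hqp
    haveI hwv : w.asIdeal.LiesOver (primesEquiv.symm ⟨q, hqp⟩ : HeightOneSpectrum (𝓞 ℚ)).asIdeal :=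
      liesOver_of_natCast_mem hqp (hplmem hqp) hqw
    -- Q2 at `w ∣ q` between `c₂(m)` and `c₂(nℓ′)`, second clause at `j = 1`
    have hRel := PlusDescent.kolyvaginRelationAtTwo_of_mul_eq W Dt β ι hQ2 hcm hK h3 h4 hHe hρ 2 h12 hmq hsq hqp hqm hnK' d'' d' hσ'' hS''
      hS''' hemb'' w hqw 1
    -- (M): every swap is imprimitive, so `2 • c₂(m) = 0`
    have hM : (2 : ℤ) • cKu = 0 := by
      have hnotP : ¬ P (insert ℓ' (n.primeFactors.erase q)) := hno q hq hqd ℓ' hdeep' hℓ'n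
      have hne4 : addOrderOf cKu ≠ 2 ^ 2 := fun h4' ↦ hnotP ⟨ℓ' * (n / q), d'', hmsq, hmpf, fun r hr ↦ ?_, h4'⟩
      · have hdvd4 : addOrderOf cKu ∣ 2 ^ 2 := by
          rw [addOrderOf_dvd_iff_nsmul_eq_zero, ← natCast_zsmul]
          exact zsmul_discreteH1_torsion _ _
        obtain ⟨k, hk2, hk⟩ := (Nat.dvd_prime_pow Nat.prime_two).mp hdvd4
        have hk1 : k ≤ 1 := by
          by_contra hk'
          exact hne4 (by rw [hk]; congr 1; omega)
        have hdvd2 : addOrderOf cKu ∣ 2 := by rw [hk]; exact (Nat.pow_dvd_pow 2 hk1).trans (by norm_num)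
        have := addOrderOf_dvd_iff_nsmul_eq_zero.mp hdvd2
        rwa [← natCast_zsmul] at this
      · rw [hmpf, Finset.mem_insert] at hr
        rcases hr with rfl | hr
        · exact hGross'
        · exact hGr r (Finset.mem_of_mem_erase hr)
    exact ⟨_, q, w, hwv, cKu, hpl hqp, hqp, hplmem hqp, intCast_notMem_of_not_dvd hqp (hplmem hqp) hKolq.2.2.1, hFrob4q,
      inertiaDeg_eq_two_of_span_isPrime h2K hqp hKolq.2.2.2.2.1 (hplmem hqp) hqw, hRel.2, hM⟩
  · -- (tr): the (V44)-socket at the deep own primes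
    intro v hvt 𝔓 h𝔓 F c₀ hF hc₀ hFc₀
    obtain ⟨q, hqf, h⟩ := Finset.mem_image.mp hvt
    obtain ⟨hq, hqd⟩ := Finset.mem_filter.mp hqf
    have hqp : q.Prime := Nat.prime_of_mem_primeFactors hq
    rw [hpl hqp] at h
    have hv : v = primesEquiv.symm ⟨q, hqp⟩ := (Sum.inr_injective h).symm
    exact hTr (n * ℓ') d' Z hsq hGr' hZ v q (by rw [hpf']; exact Finset.mem_insert_of_mem hq) (hv ▸ hplmem hqp) hqd.2.1 hqd.2.2
      𝔓 h𝔓 F c₀ hF hc₀ hFc₀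

end Summit.BirchSwinnertonDyer.BirchSwinnertonDyer.Theorems.GenusExact.RelaxedCount

end
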